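import Summits.Ventures.LatticeQCDFlow.Scoring.HermiteOrthogonality
import Summits.Ventures.LatticeQCDFlow.Scoring.BesselToeplitzAndreief
import Literature.RepresentationTheory.CompactGroups.WeylIntegrationAdAction
import Mathlib.LinearAlgebra.Vandermonde
import Mathlib.Data.Nat.Factorial.SuperFactorial
import Mathlib.MeasureTheory.Integral.Pi
import HarnessLib

/-!
# Mehta's integral: `∫_{ℝ^N} e^{−|φ|²/2} Π_{j≺k} (φ_j − φ_k)² dφ = (2π)^{N/2} Π_{j=1}^{N} j!` (the normalisation of the Gaussian unitary ensemble), by Hermite orthogonality and Andréief's identity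

HONEST FRAMING: exact (Metropolis-corrected) sampling algorithms for lattice gauge theory;
figures of merit are autocorrelation/cost numbers at stated couplings and volumes; no
continuum-physics claim.

Venture `LatticeQCDFlow` (cell pub-lqcd), sub-topic `Scoring`; FANOUT row 5 (`s0-sun-a`), GEN-20.
NEW WORK of the cell (placement rule).  The constant of GEN-20's weak-coupling law of the `U(N)` one-plaquette
partition function (`BesselToeplitzLaplace`: `det[I_{|i−j|}(x)] e^{−Nx} √x^{N²} → M_N/((2π)^N N!)` with
`M_N = ∫_{ℝ^N} e^{−Σφ_b²/2} Π_{j≺k}(φ_j − φ_k)² dφ`) in closed form, for EVERY `N`: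

* §1 the Vandermonde square: `sq_prod_prod_Ioi_sub_eq_prod_offDiag` (`(Π_{i<j}(v_j − v_i))² = Π_i Π_{j≠i}|v_i − v_j|`),
  **`prod_OD_sub_sq_eq_det_vandermonde_sq`** (`Π_{j≺k}(v_j − v_k)² = det(V)²` for the tree's ordered pairs `OD`),
  `det_vandermonde_eq_det_hermite` (`det V = det[He_j(v_i)]`: column operations, Mathlib's
  `det_eval_matrixOfPolynomials_eq_det_vandermonde` with the monic Hermite polynomials);
* §2 `det_sq_eq_sum_sum` (the double Leibniz expansion `det A² = Σ_{σ,τ} ε_σ ε_τ Π_b A_{b,σ⁻¹b} A_{b,τ⁻¹b}`),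
  `integrable_prod_hermite_mul_hermite_gaussian`;
* §3 **`gaussVandermonde_eq_superFactorial`** — MEHTA'S INTEGRAL:
  `∫_{ℝ^N} e^{−Σ_bφ_b²/2} Π_{j≺k}(φ_j − φ_k)² dφ = √(2π)^N · sf(N)`, `sf(N) = Π_{j=1}^{N} j!` (Mathlib's `Nat.superFactorial`):
  Fubini term by term (`integral_fintype_prod_volume_eq_prod`), the Hermite Gram matrix `√(2π) i! δ_{ij}`
  (`HermiteOrthogonality`), and GEN-17's finite Andréief identity `Σ_{σ,τ} ε_σ ε_τ Π_b G(σ⁻¹b, τ⁻¹b) = N! det G`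
  (`sum_sum_sign_mul_sign_mul_prod_eq_factorial_mul_det`), `N! Π_{i<N} i! = sf(N)`.

Hence (sibling corollary file) `det[I_{|i−j|}(x)]_{N×N} ~ (2π)^{−N/2} sf(N−1) · e^{Nx} x^{−N²/2}` and the 2-d `U(N)`
free energy constant `K_N = log sf(N−1) − (N/2) log 2π`.  No `def`, nothing cited as a fact, 0 sorry.
-/

noncomputable section

open Real MeasureTheory Filter Topology Finset Polynomial
open Literature.RepresentationTheory.CompactGroups.WeylIntegration (OD enum prod_OD_sub_sq_eq_prod_offDiag)

namespace Summit.Ventures.LatticeQCDFlow.Scoring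

/-! ### 1. The Vandermonde square -/

/-- `(Π_i Π_{j>i} (v_j − v_i))² = Π_i Π_{j≠i} |v_i − v_j|` on `Fin N`. -/
theorem sq_prod_prod_Ioi_sub_eq_prod_offDiag {N : ℕ} (v : Fin N → ℝ) :
    (∏ i : Fin N, ∏ j ∈ Ioi i, (v j - v i)) ^ 2 = ∏ i : Fin N, ∏ j ∈ univ.erase i, |v i - v j| := by
  -- split `univ.erase i = Ioi i ∪ Iio i`
  have hsplit : ∀ i : Fin N, ∏ j ∈ univ.erase i, |v i - v j|
      = (∏ j ∈ Ioi i, |v i - v j|) * ∏ j ∈ Iio i, |v i - v j| := by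
    intro i
    rw [← Finset.prod_disjUnion (disjoint_Ioi_Iio i), Finset.Ioi_disjUnion_Iio,
      Finset.compl_eq_univ_sdiff, Finset.sdiff_singleton_eq_erase]
  simp_rw [hsplit]
  rw [Finset.prod_mul_distrib]
  -- swap the second double product: pairs `j < i`
  have hswap : ∏ i : Fin N, ∏ j ∈ Iio i, |v i - v j| = ∏ j : Fin N, ∏ i ∈ Ioi j, |v i - v j| :=
    Finset.prod_comm' fun i j => by simp
  rw [hswap]
  have habs : ∀ i : Fin N, ∏ j ∈ Ioi i, |v i - v j| = ∏ j ∈ Ioi i, |v j - v i| :=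
    fun i => Finset.prod_congr rfl fun j _ => abs_sub_comm _ _
  simp_rw [habs, ← Finset.abs_prod]
  rw [← sq, sq_abs]

/-- **`Π_{j≺k} (v_j − v_k)² = (det V)²`** for the Vandermonde matrix `V_{ij} = v_i^j` and the tree's ordered pairs `OD (Fin N)`. -/
theorem prod_OD_sub_sq_eq_det_vandermonde_sq {N : ℕ} (v : Fin N → ℝ) :
    ∏ p : OD (Fin N), (v p.1.1 - v p.1.2) ^ 2 = (Matrix.vandermonde v).det ^ 2 := by
  rw [prod_OD_sub_sq_eq_prod_offDiag, Matrix.det_vandermonde, sq_prod_prod_Ioi_sub_eq_prod_offDiag]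

/-- **`det V = det[He_j(v_i)]`**: column operations replace the monomials by the monic Hermite polynomials. -/
theorem det_vandermonde_eq_det_hermite {N : ℕ} (v : Fin N → ℝ) :
    (Matrix.vandermonde v).det = (Matrix.of fun i j : Fin N => aeval (v i) (hermite j)).det := by
  rw [Matrix.det_eval_matrixOfPolynomials_eq_det_vandermonde v (fun j : Fin N => (hermite j).map (Int.castRingHom ℝ))
    (fun j => by rw [natDegree_map_eq_of_injective Int.cast_injective, natDegree_hermite])
    (fun j => (hermite_monic j).map _)]
  congr 1
  ext i j
  simp only [Matrix.of_apply, aeval_hermite_eq_eval_map]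

/-! ### 2. The double Leibniz expansion and term-wise integrability -/

/-- `det A² = Σ_σ Σ_τ ε_σ ε_τ Π_b A_{b, σ⁻¹ b} A_{b, τ⁻¹ b}`. -/
theorem det_sq_eq_sum_sum {N : ℕ} (A : Matrix (Fin N) (Fin N) ℝ) :
    A.det ^ 2 = ∑ σ : Equiv.Perm (Fin N), ∑ τ : Equiv.Perm (Fin N),
      ((Equiv.Perm.sign σ : ℤ) : ℝ) * ((Equiv.Perm.sign τ : ℤ) : ℝ) * ∏ b, (A b (σ.symm b) * A b (τ.symm b)) := by
  have hdet : A.det = ∑ σ : Equiv.Perm (Fin N), ((Equiv.Perm.sign σ : ℤ) : ℝ) * ∏ b, A b (σ.symm b) := by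
    rw [Matrix.det_apply']
    refine Finset.sum_congr rfl fun σ _ => ?_
    congr 1
    rw [← Equiv.prod_comp σ (fun b => A b (σ.symm b))]
    simp only [Equiv.symm_apply_apply]
  rw [sq, hdet, Finset.sum_mul_sum]
  refine Finset.sum_congr rfl fun σ _ => Finset.sum_congr rfl fun τ _ => ?_
  rw [Finset.prod_mul_distrib]
  ring

/-- Each term `Π_b He_{i_b}(φ_b) He_{j_b}(φ_b) e^{−φ_b²/2}` is integrable on `ℝ^N`. -/
theorem integrable_prod_hermite_mul_hermite_gaussian {N : ℕ} (i j : Fin N → ℕ) :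
    Integrable (fun φ : Fin N → ℝ => ∏ b, (aeval (φ b) (hermite (i b)) * aeval (φ b) (hermite (j b)) *
      Real.exp (-(φ b ^ 2 / 2)))) := by
  rw [volume_pi]
  refine Integrable.fintype_prod (f := fun b t => aeval t (hermite (i b)) * aeval t (hermite (j b)) *
    Real.exp (-(t ^ 2 / 2))) fun b => ?_
  have h := integrable_polynomial_mul_gaussian
    ((hermite (i b)).map (Int.castRingHom ℝ) * (hermite (j b)).map (Int.castRingHom ℝ))
  refine h.congr (Eventually.of_forall fun t => ?_)
  simp only [eval_mul, aeval_hermite_eq_eval_map]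

/-! ### 3. Mehta's integral -/

/-- `N! · Π_{i<N} i! = sf(N)`. -/
theorem factorial_mul_prod_factorial_eq_superFactorial (N : ℕ) :
    ((Nat.factorial N) : ℝ) * ∏ i : Fin N, ((Nat.factorial (i : ℕ)) : ℝ) = (N.superFactorial : ℝ) := by
  rw [Fin.prod_univ_eq_prod_range (fun i => ((Nat.factorial i) : ℝ)) N]
  cases N with
  | zero => simp
  | succ M =>
    rw [Nat.superFactorial_succ, Nat.cast_mul, ← Nat.prod_range_succ_factorial M]
    push_cast
    ring

/-- **MEHTA'S INTEGRAL**: `∫_{ℝ^N} e^{−Σ_b φ_b²/2} Π_{j≺k} (φ_j − φ_k)² dφ = √(2π)^N · sf(N)`, `sf(N) = Π_{j=1}^{N} j!`, for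
every `N` (the normalisation constant of the Gaussian unitary ensemble). -/
theorem gaussVandermonde_eq_superFactorial (N : ℕ) :
    ∫ φ : Fin N → ℝ, Real.exp (∑ b, -(φ b ^ 2 / 2)) * ∏ p : OD (Fin N), (φ p.1.1 - φ p.1.2) ^ 2
      = √(2 * π) ^ N * N.superFactorial := by
  -- rewrite the integrand as the double Leibniz sum of products of one-variable functions
  have hpt : ∀ φ : Fin N → ℝ, Real.exp (∑ b, -(φ b ^ 2 / 2)) * ∏ p : OD (Fin N), (φ p.1.1 - φ p.1.2) ^ 2
      = ∑ σ : Equiv.Perm (Fin N), ∑ τ : Equiv.Perm (Fin N),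
        ((Equiv.Perm.sign σ : ℤ) : ℝ) * ((Equiv.Perm.sign τ : ℤ) : ℝ) *
          ∏ b, (aeval (φ b) (hermite (σ.symm b)) * aeval (φ b) (hermite (τ.symm b)) * Real.exp (-(φ b ^ 2 / 2))) := by
    intro φ
    rw [prod_OD_sub_sq_eq_det_vandermonde_sq, det_vandermonde_eq_det_hermite, det_sq_eq_sum_sum, Finset.mul_sum]
    refine Finset.sum_congr rfl fun σ _ => ?_
    rw [Finset.mul_sum]
    refine Finset.sum_congr rfl fun τ _ => ?_
    rw [Real.exp_sum, mul_left_comm, ← Finset.prod_mul_distrib]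
    congr 1
    refine Finset.prod_congr rfl fun b _ => ?_
    simp only [Matrix.of_apply]
    ring
  simp_rw [hpt]
  have hint : ∀ σ τ : Equiv.Perm (Fin N), Integrable (fun φ : Fin N → ℝ =>
      ((Equiv.Perm.sign σ : ℤ) : ℝ) * ((Equiv.Perm.sign τ : ℤ) : ℝ) *
        ∏ b, (aeval (φ b) (hermite (σ.symm b)) * aeval (φ b) (hermite (τ.symm b)) * Real.exp (-(φ b ^ 2 / 2)))) :=
    fun σ τ => (integrable_prod_hermite_mul_hermite_gaussian _ _).const_mul _
  rw [integral_finsetSum _ (fun σ _ => integrable_finsetSum _ (fun τ _ => hint σ τ))]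
  simp_rw [integral_finsetSum _ (fun τ _ => hint _ τ), integral_const_mul]
  -- Fubini, term by term: `∫ Π_b f_b(φ_b) dφ = Π_b ∫ f_b`
  have hF : ∀ σ τ : Equiv.Perm (Fin N),
      ∫ φ : Fin N → ℝ, ∏ b, (aeval (φ b) (hermite (σ.symm b)) * aeval (φ b) (hermite (τ.symm b)) *
        Real.exp (-(φ b ^ 2 / 2)))
        = ∏ b, (Matrix.of fun i j : Fin N => if i = j then √(2 * π) * ((Nat.factorial (i : ℕ)) : ℝ) else 0) (σ.symm b) (τ.symm b) := by
    intro σ τ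
    rw [integral_fintype_prod_volume_eq_prod (f := fun b t => aeval t (hermite (σ.symm b)) *
      aeval t (hermite (τ.symm b)) * Real.exp (-(t ^ 2 / 2)))]
    refine Finset.prod_congr rfl fun b _ => ?_
    rw [integral_hermite_mul_hermite_gaussian, Matrix.of_apply]
    simp only [Fin.ext_iff]
    split_ifs with h
    · rw [h]
    · rfl
  simp_rw [hF]
  rw [sum_sum_sign_mul_sign_mul_prod_eq_factorial_mul_det, Fintype.card_fin]
  -- the Gram matrix is diagonal
  have hdiag : (Matrix.of fun i j : Fin N => if i = j then √(2 * π) * ((Nat.factorial (i : ℕ)) : ℝ) else 0)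
      = Matrix.diagonal fun i : Fin N => √(2 * π) * ((Nat.factorial (i : ℕ)) : ℝ) := by
    ext i j
    simp only [Matrix.of_apply, Matrix.diagonal_apply]
  rw [hdiag, Matrix.det_diagonal, Finset.prod_mul_distrib, Finset.prod_const, Finset.card_univ, Fintype.card_fin,
    ← factorial_mul_prod_factorial_eq_superFactorial]
  ring

end Summit.Ventures.LatticeQCDFlow.Scoring
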